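import Summits.BirchSwinnertonDyer.BirchSwinnertonDyer.Theorems.SylvesterTwoHeegnerIndexCoupledDescentCebotarevBottomClass
import Literature.NumberTheory.EllipticCurves.HeegnerPointsKolyvaginExceptionalProofs
import Literature.NumberTheory.EllipticCurves.MordellWeilTheoremProofs
import HarnessLib

/-!
# The image `δ(E_p(K)) ⊆ H¹(K, E_p[2])` of the Kummer map and its `𝔽₄`-line (toward (hL3b), (C4)-free)

Infrastructure for leaf (L3b) of VARIANT K (crux `UpperOffV0HSYPlus`, stmt-BirchSwinnertonDyer-19804)
at `p = 2`; consumed by `…CoupledDescentCebotarevRankTwo.lean`, which DISCHARGES the datum (C4) of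
#12's `exists_cmH1_infinite_kolyvaginPrimes_line_sylvesterPair` (a `c_*`-fixed generator of the
`𝔽₄`-line of `δY`) from `rank_ℤ E_p(K) = 2` alone.

* §A (any field) `resH1Hom_id_kummerClassTorsion`, `resH1Hom_id_kummerMapTorsion`: for an additive
  `Γ_K`-equivariant `φ` on `E(K̄)` restricting to `fn` on `E[n]`, `H¹(fn) ∘ δ = δ ∘ φ` on Kummer
  classes (cocycle level: `H¹(fn)[g ↦ gQ − Q] = [g ↦ g(φQ) − φQ]`).
* §B (pure algebra) `exists_conj_fixed_generator_of_mem_line`: for additive `c, w` with `c ∘ c = id`,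
  `w² + w + 1 = 0`, and `y` with `2 • y = 0` and `c y` on the line `{a • y + b • w y}`, some `x₁` on that
  line is `c`-FIXED and spans the same line (case analysis on `c y ∈ {0, y, wy, y + wy}`; no
  semilinearity used) — exactly #12's three (C4) binders; `exists_eq_line_of_natCard_le_four`: a
  subgroup with at most four elements containing `y ≠ 0` and `w y` IS that line.
* §C (`E_p` over `K ∋ ω`) `smul_comm_of_apply_some_eq` (equivariance of a map acting by
  `(x, y) ↦ (ω² x, y)`), `exists_toGeomPoints_eq_apply` (the point-level `[ζ]` on `E_p(K)`),
  `natCard_range_kummerMapTorsion_cubeSumCurve`: `#δ(E_p(K)) = #(E_p(K)/2E_p(K)) = 2^{rank} = 4` when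
  `rank_ℤ E_p(K) = 2` (`E_p(ℚ(ω))[2] = 0`, #13's `cubeSumCurve_prime_eq_zero_of_two_pow_smul_eq_zero`;
  Mordell–Weil `module_finite_point_holds`; `natCard_quotient_range_zsmul_eq`).
Theorem-only; nothing asserted on 19804; no label moves; BSD not claimed for any curve.
References: Silverman AEC VIII.§2, X.4.2; Serre, Galois Cohomology I.§2.4; Gross 1991 §2 (2.2), §5.
-/

set_option linter.dupNamespace false -- Summits modules are `Summit.<Summit>.<Problem>…` by design

noncomputable section

open scoped Classical
open WeierstrassCurve NumberField IsDedekindDomain Field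
open Literature.NumberTheory.EllipticCurves Literature.NumberTheory.GaloisRepresentations
open Literature.NumberTheory.EllipticCurves.HuShuYin2019

namespace Summit.BirchSwinnertonDyer.BirchSwinnertonDyer.Theorems.SylvesterTwoCoupledDescentCebotarev

universe u

/-! ## §A  `H¹(fn) ∘ δ = δ ∘ φ` for an endomorphism `φ` of `E(K̄)` with `fn = φ|E[n]` -/

section KummerFunctoriality

variable {K : Type u} [Field K] (W : WeierstrassCurve K) (n : ℤ)
  (φ : geomPoints W →+ geomPoints W)
  (hφ : ∀ (g : Field.absoluteGaloisGroup K) (P : geomPoints W), φ (g • P) = g • φ P)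
  (fn : geomTorsion W n →+ geomTorsion W n)
  (hfn : ∀ (g : Field.absoluteGaloisGroup K) (P : geomTorsion W n),
    fn (ContinuousMonoidHom.id _ g • P) = g • fn P)
  (hcoe : ∀ P : geomTorsion W n, ((fn P : geomTorsion W n) : geomPoints W) = φ P)

include hφ hcoe in
/-- **`H¹(fn) [g ↦ gQ − Q] = [g ↦ g(φQ) − φQ]`**: for a `Γ_K`-equivariant additive `φ` on `E(K̄)`
restricting to `fn` on `E[n]`, the map `H¹(K, E[n]) → H¹(K, E[n])` induced by `fn` sends the Kummer
class of a division point `Q` to the Kummer class of `φ Q` (the pulled-back cocycle is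
`g ↦ fn (gQ − Q) = φ(gQ) − φQ = g(φQ) − φQ`). Serre, *Galois Cohomology*, I.§2.4; Gross 1991, §5.
[folklore] -/
theorem resH1Hom_id_kummerClassTorsion (Q : geomPoints W)
    (hQ : n • Q ∈ MulAction.fixedPoints (Field.absoluteGaloisGroup K) (geomPoints W))
    (hQ' : n • φ Q ∈ MulAction.fixedPoints (Field.absoluteGaloisGroup K) (geomPoints W)) :
    resH1Hom (ContinuousMonoidHom.id _) fn hfn (kummerClassTorsion W n Q hQ) =
      kummerClassTorsion W n (φ Q) hQ' := by
  unfold kummerClassTorsion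
  change ContinuousCohomology.map (ContinuousMonoidHom.id _)
      (resHomOfEquivariant (ContinuousMonoidHom.id _) fn hfn) 1 (oneCocycleClass _ _) = _
  rw [map_oneCocycleClass]
  congr 1
  apply Subtype.ext
  ext g : 1
  apply Subtype.ext
  rw [contOneCocycles.pullback_apply]
  change ((fn ((kummerCocycleTorsion W n Q hQ).1 g) : geomTorsion W n) : geomPoints W) =
    g • φ Q - φ Q
  rw [hcoe, coe_kummerCocycleTorsion_apply, map_sub, hφ]

include hφ hcoe in
/-- **`H¹(fn) (δ P) = δ P'` whenever `φ` maps (the image of) `P ∈ E(K)` to (the image of)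
`P' ∈ E(K)`** — with `n • φR = φ(nR) = φ(P) = P'` for a root `R` of `P`, by
`resH1Hom_id_kummerClassTorsion` and the root-independence of the Kummer map. [folklore] -/
theorem resH1Hom_id_kummerMapTorsion
    (hdiv : ∀ P : geomPoints W, ∃ Q : geomPoints W, n • Q = P)
    (P P' : W.toAffine.Point) (hPP' : φ (toGeomPoints W P) = toGeomPoints W P') :
    resH1Hom (ContinuousMonoidHom.id _) fn hfn (kummerMapTorsion W n hdiv P) =
      kummerMapTorsion W n hdiv P' := by
  have hR : n • φ (zsmulRoot W n hdiv P) = toGeomPoints W P' := by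
    rw [← map_zsmul, zsmul_zsmulRoot, hPP']
  rw [kummerMapTorsion_apply, kummerMapTorsion_apply, kummerMapTorsionFun,
    kummerMapTorsionFun_eq W n hdiv P' _ hR]
  exact resH1Hom_id_kummerClassTorsion W n φ hφ fn hfn hcoe _ _ _

end KummerFunctoriality

/-! ## §B  Pure algebra: the `𝔽₄`-line of `y` and a `c`-fixed generator -/

section Algebra

variable {V : Type*} [AddCommGroup V]

/-- `a • y = (a % 2) • y` when `2 • y = 0`. [folklore] -/
private theorem zsmul_eq_emod_two_zsmul {y : V} (hy2 : (2 : ℤ) • y = 0) (a : ℤ) :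
    a • y = (a % 2) • y := by
  obtain ⟨k, hk⟩ : ∃ k : ℤ, a = a % 2 + k * 2 := ⟨a / 2, by omega⟩
  conv_lhs => rw [hk]
  rw [add_zsmul, mul_zsmul, hy2, zsmul_zero, add_zero]

/-- With `2 • y = 0` and `2 • z = 0`, every `a • y + b • z` is one of `0, y, z, y + z`. [folklore] -/
private theorem line_cases {y z : V} (hy2 : (2 : ℤ) • y = 0) (hz2 : (2 : ℤ) • z = 0) (a b : ℤ) :
    a • y + b • z = 0 ∨ a • y + b • z = y ∨ a • y + b • z = z ∨ a • y + b • z = y + z := by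
  rw [zsmul_eq_emod_two_zsmul hy2 a, zsmul_eq_emod_two_zsmul hz2 b]
  rcases Int.emod_two_eq_zero_or_one a with ha | ha <;>
    rcases Int.emod_two_eq_zero_or_one b with hb | hb <;>
    simp [ha, hb]

variable (c w : V →+ V)

/-- From the relation `w (w x) + w x + x = 0`: `w (w x) = -w x - x`. [folklore] -/
private theorem w_w_eq (hw : ∀ x, w (w x) + w x + x = 0) (x : V) : w (w x) = -w x - x := by
  have h := hw x
  rw [add_assoc, add_eq_zero_iff_eq_neg, neg_add'] at h
  exact h

/-- `2 • w y = 0` when `2 • y = 0`. [folklore] -/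
private theorem two_zsmul_w_eq_zero {y : V} (hy2 : (2 : ℤ) • y = 0) : (2 : ℤ) • w y = 0 := by
  rw [← map_zsmul, hy2, map_zero]

/-- **A `c`-fixed generator of the line of `y`.** Let `c, w` be additive endomorphisms of `V` with
`c ∘ c = id` and `w² + w + 1 = 0`, and `y ∈ V` with `2 • y = 0` whose image `c y` lies on the
"`𝔽₄`-line" `{a • y + b • w y}` of `y`. Then some `x₁` on that line is FIXED by `c`, and `y` lies on
the line of `x₁` (so the two lines coincide): by cases, `c y = y ⇒ x₁ = y`; `c y = w y ⇒
x₁ = y + w y` (`c (w y) = c (c y) = y`); `c y = y + w y ⇒ x₁ = w y` (`c (w y) = y − c y = −w y = w y`);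
`c y = 0 ⇒ y = 0`. No semilinearity of `c` with respect to `w` is used. These are exactly the three
(C4) binders of `exists_cmH1_infinite_kolyvaginPrimes_line_sylvesterPair`. [folklore] -/
theorem exists_conj_fixed_generator_of_mem_line (hcc : ∀ x, c (c x) = x)
    (hw : ∀ x, w (w x) + w x + x = 0) {y : V} (hy2 : (2 : ℤ) • y = 0)
    (hcy : ∃ a b : ℤ, c y = a • y + b • w y) :
    ∃ x₁ : V, c x₁ = x₁ ∧ (∃ α β : ℤ, y = α • x₁ + β • w x₁) ∧
      ∀ a b : ℤ, ∃ a' b' : ℤ, a • x₁ + b • w x₁ = a' • y + b' • w y := by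
  have hwy2 := two_zsmul_w_eq_zero w hy2
  have hww := w_w_eq w hw y
  obtain ⟨a, b, hab⟩ := hcy
  rcases line_cases hy2 hwy2 a b with h | h | h | h <;> rw [h] at hab
  · -- `c y = 0`, so `y = 0`
    have hy0 : y = 0 := by rw [← hcc y, hab, map_zero]
    exact ⟨y, by rw [hab, hy0], ⟨1, 0, by rw [one_zsmul, zero_zsmul, add_zero]⟩,
      fun a b ↦ ⟨a, b, rfl⟩⟩
  · -- `c y = y`
    exact ⟨y, hab, ⟨1, 0, by rw [one_zsmul, zero_zsmul, add_zero]⟩, fun a b ↦ ⟨a, b, rfl⟩⟩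
  · -- `c y = w y`: take `x₁ = y + w y`
    have hcwy : c (w y) = y := by rw [← hab, hcc]
    refine ⟨y + w y, by rw [map_add, hab, hcwy, add_comm], ⟨0, -1, ?_⟩, fun a b ↦ ⟨a - b, a, ?_⟩⟩
    · rw [map_add, hww]; module
    · rw [map_add, hww]; module
  · -- `c y = y + w y`: take `x₁ = w y`
    have hneg : -w y = w y := by
      rw [neg_eq_iff_add_eq_zero, ← two_zsmul]; exact hwy2
    have hcwy : c (w y) = w y := by
      have e : w y = c y - y := by rw [hab, add_sub_cancel_left]
      conv_lhs => rw [e, map_sub, hcc, hab]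
      rw [sub_add_cancel_left, hneg]
    refine ⟨w y, hcwy, ⟨-1, -1, ?_⟩, fun a b ↦ ⟨-b, a - b, ?_⟩⟩
    · rw [hww]; module
    · rw [hww]; module

/-- **A four-element subgroup containing `y ≠ 0` and `w y` IS the line of `y`.** For `w` with
`w² + w + 1 = 0`, a finite subgroup `M ≤ V` with `#M ≤ 4`, and `y ∈ M` with `y ≠ 0`, `2 • y = 0`,
`w y ∈ M`: the four elements `0, y, w y, y + w y` are pairwise distinct members of `M`, hence all of
`M`; so every `z ∈ M` is `a • y + b • w y`. [folklore] -/
theorem exists_eq_line_of_natCard_le_four (hw : ∀ x, w (w x) + w x + x = 0) (M : AddSubgroup V)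
    [Finite M] (hM : Nat.card M ≤ 4) {y : V} (hy0 : y ≠ 0) (hy2 : (2 : ℤ) • y = 0) (hyM : y ∈ M)
    (hwyM : w y ∈ M) {z : V} (hz : z ∈ M) : ∃ a b : ℤ, z = a • y + b • w y := by
  have hww := w_w_eq w hw y
  have hneg : -y = y := by
    rw [neg_eq_iff_add_eq_zero, ← two_zsmul]; exact hy2
  -- the four elements are pairwise distinct
  have hwy0 : w y ≠ 0 := by
    intro h
    apply hy0
    have := hw y
    rwa [h, map_zero, zero_add, zero_add] at this
  have hwyy : w y ≠ y := by
    intro h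
    apply hy0
    have := hw y
    rw [h, h, ← two_nsmul, ← natCast_zsmul, Nat.cast_ofNat, hy2, zero_add] at this
    exact this
  have hs0 : y + w y ≠ 0 := by
    intro h
    apply hwyy
    rw [add_eq_zero_iff_neg_eq, hneg] at h
    exact h.symm
  have hsy : y + w y ≠ y := by
    intro h; apply hwy0; simpa using h
  have hswy : y + w y ≠ w y := by
    intro h; apply hy0; simpa using h
  -- the set `S = {0, y, w y, y + w y}` has four elements and lies in `M`
  set S : Set V := {0, y, w y, y + w y} with hSdef
  have hSM : S ⊆ (M : Set V) := by
    intro x hx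
    simp only [hSdef, Set.mem_insert_iff, Set.mem_singleton_iff] at hx
    rcases hx with rfl | rfl | rfl | rfl
    · exact M.zero_mem
    · exact hyM
    · exact hwyM
    · exact M.add_mem hyM hwyM
  have hScard : S.ncard = 4 := by
    rw [hSdef, Set.ncard_insert_of_notMem, Set.ncard_insert_of_notMem, Set.ncard_insert_of_notMem,
      Set.ncard_singleton]
    · simpa [eq_comm] using hswy
    · simp only [Set.mem_insert_iff, Set.mem_singleton_iff, not_or]
      exact ⟨hwyy.symm, hsy.symm⟩
    · simp only [Set.mem_insert_iff, Set.mem_singleton_iff, not_or]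
      exact ⟨hy0.symm, hwy0.symm, hs0.symm⟩
  have hMfin : (M : Set V).Finite := Set.toFinite _
  have hSeq : S = (M : Set V) :=
    Set.eq_of_subset_of_ncard_le hSM (by rw [hScard, ← Nat.card_coe_set_eq]; exact hM) hMfin
  have hzS : z ∈ S := by rw [hSeq]; exact hz
  simp only [hSdef, Set.mem_insert_iff, Set.mem_singleton_iff] at hzS
  rcases hzS with rfl | rfl | rfl | rfl
  · exact ⟨0, 0, by rw [zero_zsmul, zero_zsmul, add_zero]⟩
  · exact ⟨1, 0, by rw [one_zsmul, zero_zsmul, add_zero]⟩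
  · exact ⟨0, 1, by rw [zero_zsmul, one_zsmul, zero_add]⟩
  · exact ⟨1, 1, by rw [one_zsmul, one_zsmul]⟩

end Algebra

/-! ## §C  The Sylvester curve `E_p` over `K = ℚ(ω)` -/

section SylvesterPair

variable {K : Type} [Field K] [NumberField K]

omit [NumberField K] in
/-- The Galois action on an affine geometric point is coordinatewise (definitional). [folklore] -/
private theorem smul_some_eq (W : WeierstrassCurve K) (g : Field.absoluteGaloisGroup K)
    {x y : AlgebraicClosure K} (h : (W.baseChange (AlgebraicClosure K)).toAffine.Nonsingular x y) :
    ∃ h', @HSMul.hSMul (Field.absoluteGaloisGroup K) (geomPoints W) (geomPoints W) instHSMul g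
        (Affine.Point.some x y h) =
      Affine.Point.some ((show AlgebraicClosure K ≃ₐ[K] AlgebraicClosure K from g) x)
        ((show AlgebraicClosure K ≃ₐ[K] AlgebraicClosure K from g) y) h' :=
  ⟨_, rfl⟩

omit [NumberField K] in
/-- **An additive map on `E(K̄)` acting by `(x, y) ↦ (ζ'² x, y)` with `ζ' ∈ K` is `Γ_K`-equivariant**
(the shape `hφB` of the `[ζ]`-package of #12). [folklore] -/
theorem smul_comm_of_apply_some_eq (W : WeierstrassCurve K) (ζ' : K)
    (φ : geomPoints W →+ geomPoints W)
    (hφ : ∀ (x y : AlgebraicClosure K)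
      (h : (W.baseChange (AlgebraicClosure K)).toAffine.Nonsingular x y),
      ∃ h', φ (Affine.Point.some x y h) =
        Affine.Point.some (algebraMap K (AlgebraicClosure K) ζ' ^ 2 * x) y h')
    (g : Field.absoluteGaloisGroup K) (P : geomPoints W) : φ (g • P) = g • φ P := by
  change (W.baseChange (AlgebraicClosure K)).toAffine.Point at P
  rcases P with _ | ⟨x, y, h⟩
  · change φ (g • (0 : geomPoints W)) = g • φ 0
    rw [smul_zero, map_zero, smul_zero]
  · obtain ⟨h₁, e₁⟩ := smul_some_eq W g h
    obtain ⟨h₂, e₂⟩ := hφ _ _ h₁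
    obtain ⟨h₃, e₃⟩ := hφ x y h
    obtain ⟨h₄, e₄⟩ := smul_some_eq W g h₃
    change φ (g • (show geomPoints W from Affine.Point.some x y h)) = _
    rw [e₁, e₂, e₃, e₄]
    refine Affine.Point.some_eq_some_of_eq ?_ rfl
    rw [map_mul, map_pow, AlgEquiv.commutes]

variable {ω : K} (hω : ω ^ 2 + ω + 1 = 0) (h2 : Module.finrank ℚ K = 2) {p : ℕ} (hp : p.Prime)

omit [NumberField K] in
/-- `ω³ = 1`. [folklore] -/
private theorem omega_pow_three (hω : ω ^ 2 + ω + 1 = 0) : ω ^ 3 = 1 := by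
  have : ω ^ 3 - 1 = (ω - 1) * (ω ^ 2 + ω + 1) := by ring
  rw [hω, mul_zero, sub_eq_zero] at this
  exact this

include hω hp in
/-- **The point-level `[ζ]` on `E_p(K)`**: for every `P ∈ E_p(K)` there is `P' ∈ E_p(K)` (namely
`(ω² x, y)` for `P = (x, y)`) whose image in `E_p(K̄)` is `φ (P)` for any `φ` acting by
`(x, y) ↦ (ω² x, y)` on affine points. [folklore] -/
theorem exists_toGeomPoints_eq_apply
    (φ : geomPoints ((cubeSumCurve (p : ℚ)).baseChange K) →+
      geomPoints ((cubeSumCurve (p : ℚ)).baseChange K))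
    (hφ : ∀ (x y : AlgebraicClosure K)
      (h : (((cubeSumCurve (p : ℚ)).baseChange K).baseChange
        (AlgebraicClosure K)).toAffine.Nonsingular x y),
      ∃ h', φ (Affine.Point.some x y h) =
        Affine.Point.some (algebraMap K (AlgebraicClosure K) ω ^ 2 * x) y h')
    (P : ((cubeSumCurve (p : ℚ)).baseChange K).toAffine.Point) :
    ∃ P' : ((cubeSumCurve (p : ℚ)).baseChange K).toAffine.Point,
      φ (toGeomPoints _ P) = toGeomPoints _ P' := by
  have hp0 : (p : ℚ) ≠ 0 := by exact_mod_cast hp.ne_zero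
  haveI := Rank1Residual.X12.CubeSumFamilies.isElliptic_cubeSumCurve hp0
  haveI hEK : ((cubeSumCurve (p : ℚ)).baseChange K).IsElliptic :=
    inferInstanceAs ((cubeSumCurve (p : ℚ)).map (algebraMap ℚ K)).IsElliptic
  rcases P with _ | ⟨x, y, h⟩
  · refine ⟨0, ?_⟩
    change φ (toGeomPoints _ 0) = toGeomPoints _ 0
    simp only [map_zero]
  · -- `P' = (ω² x, y)` is on the curve `y² = x³ + a₆` since `(ω²)³ = 1`
    have heq : ((cubeSumCurve (p : ℚ)).baseChange K).toAffine.Equation (ω ^ 2 * x) y := by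
      have hx := h.1
      rw [WeierstrassCurve.Affine.equation_iff] at hx ⊢
      have h1 : ((cubeSumCurve (p : ℚ)).baseChange K).a₁ = 0 := by
        change algebraMap ℚ K 0 = 0; rw [map_zero]
      have h2' : ((cubeSumCurve (p : ℚ)).baseChange K).a₂ = 0 := by
        change algebraMap ℚ K 0 = 0; rw [map_zero]
      have h3 : ((cubeSumCurve (p : ℚ)).baseChange K).a₃ = 0 := by
        change algebraMap ℚ K 0 = 0; rw [map_zero]
      have h4 : ((cubeSumCurve (p : ℚ)).baseChange K).a₄ = 0 := by
        change algebraMap ℚ K 0 = 0; rw [map_zero]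
      rw [h1, h2', h3, h4] at hx ⊢
      have h6 : (ω ^ 2) ^ 3 = 1 := by
        rw [← pow_mul, show 2 * 3 = 3 * 2 by norm_num, pow_mul, omega_pow_three hω, one_pow]
      calc y ^ 2 + 0 * (ω ^ 2 * x) * y + 0 * y = y ^ 2 + 0 * x * y + 0 * y := by ring
        _ = x ^ 3 + 0 * x ^ 2 + 0 * x + ((cubeSumCurve (p : ℚ)).baseChange K).a₆ := hx
        _ = (ω ^ 2 * x) ^ 3 + 0 * (ω ^ 2 * x) ^ 2 + 0 * (ω ^ 2 * x) +
            ((cubeSumCurve (p : ℚ)).baseChange K).a₆ := by rw [mul_pow, h6, one_mul]; ring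
    have hns : ((cubeSumCurve (p : ℚ)).baseChange K).toAffine.Nonsingular (ω ^ 2 * x) y :=
      (WeierstrassCurve.Affine.equation_iff_nonsingular).mp heq
    refine ⟨Affine.Point.some _ _ hns, ?_⟩
    obtain ⟨h₀, e₀⟩ : ∃ h₀, toGeomPoints ((cubeSumCurve (p : ℚ)).baseChange K)
        (Affine.Point.some x y h) =
        (show geomPoints ((cubeSumCurve (p : ℚ)).baseChange K) from
          Affine.Point.some (algebraMap K (AlgebraicClosure K) x)
            (algebraMap K (AlgebraicClosure K) y) h₀) := ⟨_, rfl⟩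
    obtain ⟨h₁, e₁⟩ : ∃ h₁, toGeomPoints ((cubeSumCurve (p : ℚ)).baseChange K)
        (Affine.Point.some (ω ^ 2 * x) y hns) =
        (show geomPoints ((cubeSumCurve (p : ℚ)).baseChange K) from
          Affine.Point.some (algebraMap K (AlgebraicClosure K) (ω ^ 2 * x))
            (algebraMap K (AlgebraicClosure K) y) h₁) := ⟨_, rfl⟩
    obtain ⟨h', e⟩ := hφ _ _ h₀
    rw [e₀, e, e₁]
    exact Affine.Point.some_eq_some_of_eq (by rw [map_mul, map_pow]) rfl

include hω h2 hp in
/-- **`#δ(E_p(K)) = 4`** for `K = ℚ(ω)` and `rank_ℤ E_p(K) = 2`: the image of the Kummer map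
`δ : E_p(K) → H¹(K, E_p[2])` is `E_p(K)/2E_p(K)` (`kummerMapTorsion_ker`), of order
`2^{rank}·#E_p(K)[2]` with `E_p(K)[2] = 0` (`cubeSumCurve_prime_eq_zero_of_two_pow_smul_eq_zero`).
Silverman, *AEC*, VIII.§2 / X.4.2; Gross 1991, §2 (sentence after (2.2)). [folklore] -/
theorem natCard_range_kummerMapTorsion_cubeSumCurve (hp2 : p ≠ 2)
    (hrank : ((cubeSumCurve (p : ℚ)).baseChange K).mordellWeilRank = 2)
    (hdiv : ∀ P : geomPoints ((cubeSumCurve (p : ℚ)).baseChange K),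
      ∃ Q : geomPoints ((cubeSumCurve (p : ℚ)).baseChange K), ((2 : ℕ) : ℤ) • Q = P) :
    Nat.card (kummerMapTorsion ((cubeSumCurve (p : ℚ)).baseChange K) ((2 : ℕ) : ℤ) hdiv).range
      = 4 := by
  set E := (cubeSumCurve (p : ℚ)).baseChange K with hE
  have hp0 : (p : ℚ) ≠ 0 := by exact_mod_cast hp.ne_zero
  haveI := Rank1Residual.X12.CubeSumFamilies.isElliptic_cubeSumCurve hp0
  haveI hEK : E.IsElliptic :=
    inferInstanceAs ((cubeSumCurve (p : ℚ)).map (algebraMap ℚ K)).IsElliptic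
  haveI : Module.Finite ℤ E.toAffine.Point := E.module_finite_point_holds
  -- no `2`-torsion
  have htors : AddSubgroup.torsionBy E.toAffine.Point ((2 : ℕ) : ℤ) = ⊥ := by
    rw [eq_bot_iff]
    intro Q hQ
    rw [AddSubgroup.mem_bot]
    refine cubeSumCurve_prime_eq_zero_of_two_pow_smul_eq_zero hω h2 hp hp2 1 Q ?_
    rw [pow_one, ← natCast_zsmul]
    exact hQ
  set κ := kummerMapTorsion E ((2 : ℕ) : ℤ) hdiv with hκ
  calc Nat.card κ.range = Nat.card (E.toAffine.Point ⧸ κ.ker) :=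
        Nat.card_congr (QuotientAddGroup.quotientKerEquivRange κ).symm.toEquiv
    _ = Nat.card (E.toAffine.Point ⧸
          (zsmulAddGroupHom (α := E.toAffine.Point) ((2 : ℕ) : ℤ)).range) :=
        Nat.card_congr (QuotientAddGroup.quotientAddEquivOfEq (kummerMapTorsion_ker E _ hdiv)).toEquiv
    _ = 2 ^ Module.finrank ℤ E.toAffine.Point := natCard_quotient_range_zsmul_eq Nat.prime_two htors
    _ = 4 := by rw [show Module.finrank ℤ E.toAffine.Point = E.mordellWeilRank from rfl, hrank]; norm_num

end SylvesterPair

end Summit.BirchSwinnertonDyer.BirchSwinnertonDyer.Theorems.SylvesterTwoCoupledDescentCebotarev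

end
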